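import Summits.NavierStokesRegularity.NavierStokesRegularity.Theorems.ScenarioCensusRowF1axAxial
import HarnessLib

/-!
# Census row F1ax (coherent axis of the fast fluid) — part 2/2: the axial singular Type-I zoom limit,
# the headline theorems, and the census keys

Part 2 of the re-homing (VERBATIM port, namespace adapted) of ns-idea-3's LINE 8 «one-way top» REV 2
(`line-one-way-top.lean`, sha16 `009ad199a5fdaef2`); provenance and statements in part 1
(`ScenarioCensusRowF1axAxial.lean`).  Here: §3 `exists_axial_zoomLimit` (at a backward-singular
final-time point the tree's singular Type-I zoom of `SqueezeCycleSingularZoom` has a pointwise limit in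
`𝒦_{C₁}`, unbounded at the origin, whose nonzero values lie on ONE line when the axis is coherent),
§4 `rowF1ax_holds : Row_F1ax`, `rowF1dir_holds : Row_F1dir`, the veering theorems
`topAxisVeering_holds` / `topVeering_holds`, `axisCoherence_iff_rowF1`, `topCoherence_iff_rowF1`; and the
census keys in namespace `…Theorems.ScenarioCensus`: `Row_F1ax` / `row_F1ax_excluded`, `Row_F1dir` /
`row_F1dir_excluded`, `AxisCoherence`, `row_F1_iff_axisCoherence`.

Values are booked by the census lead, not by this file; NS regularity is NOT proved; no summit statement
is proved by this file.

## References

* D. Albritton, T. Barker, arXiv:1811.00502, §3 (singular zooms). [AlbrittonBarker2019]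
* G. Koch, N. Nadirashvili, G. Seregin, V. Šverák, Acta Math. 203 (2009) = arXiv:0709.3599, Lemma 6.1.
  [KochNadirashviliSereginSverak2009]
-/

set_option linter.dupNamespace false

noncomputable section

open MeasureTheory Set Function Filter TopologicalSpace Metric
open scoped Topology NNReal ENNReal InnerProductSpace RealInnerProductSpace

namespace Summit.NavierStokesRegularity.NavierStokesRegularity.Theorems.ScenarioCensus.OneWayTop

open Literature.Analysis Literature.Analysis.FluidPDE
open Summit.NavierStokesRegularity.NavierStokesRegularity.Theorems

/-! ## §3 The axial singular Type-I zoom limit -/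

/-- **The singular Type-I zoom limit of a coherent axis is axial and nontrivial.**  Steps (1)–(4) and
(6) are the tree's `singularZoom_zoomLimit` verbatim (rate window, Morrey bound, unit zoom, scales
`c_k = 1/(k+4)`, `C¹_loc` extraction, unboundedness at the origin); step (4b) is new: a coherent axis
passes to the pointwise limit as «all nonzero values of `W` lie on one line `ℝe`».
(refs: AlbrittonBarker2019, §3; KochNadirashviliSereginSverak2009, Lemma 6.1 (arXiv p. 11); arXiv:1310.6471, §5 Step 3) -/
theorem exists_axial_zoomLimit {ν T : ℝ} (hν : 0 < ν) (hT : 0 < T)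
    {u : ℝ → E3 → E3} {p : ℝ → E3 → ℝ}
    (hsol : IsClassicalNSSolutionOn (Ico 0 T) ν 0 u p) (hLH : IsLerayHopfOn T ν 0 (u 0) u)
    (hdec : HasRapidSpatialDecay (u 0)) (hTI : IsTypeIBlowup u T) (hcoh : HasCoherentAxis u T)
    (x₀ : E3)
    (hsing : ∀ r : ℝ, 0 < r →
      eLpNorm (uncurry u) ∞ (volume.restrict (parabolicCylinder r ((T : ℝ), x₀))) = ∞) :
    ∃ (C : ℝ) (W : ℝ → E3 → E3) (e : E3), IsTypeIAncientMild C W ∧ ‖e‖ = 1 ∧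
      (∀ t < 0, ∀ y, W t y = ⟪W t y, e⟫ • e) ∧ ∃ t < 0, ∃ y, W t y ≠ 0 := by
  -- ## (1) the Type-I rate window, the Morrey bound and the unit zoom at `(T, x₀)`
  obtain ⟨C, δ, -, hδ, hδT, hrate⟩ := exists_typeI_rate_window hT hTI
  obtain ⟨r₀, M₀, T₁, hr₀, hT₁, hMor⟩ := morrey_of_typeI hν hT hsol hLH hTI
  obtain ⟨R, α, β, hR, hα, hβ, hβeq, hαeq, hβT, hball, hGv, htypeI⟩ :=
    exists_zoom_typeIBound_lt_top_of_morrey hν hT hsol hLH hr₀ hT₁ hMor x₀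
  set v : ℝ → E3 → E3 := α • stPull β R T x₀ u with hv
  set πv : ℝ → E3 → ℝ :=
    α ^ 2 • stPull β R T x₀ (fun t x => p t x - (p t 0 - normalisedPressure (u t) 0)) with hπv
  set Gv : ℝ → E3 → E3 →L[ℝ] E3 :=
    (α * R) • stPull β R T x₀ (fun t x => fderiv ℝ (u t) x) with hGvdef
  set I₀ : ℝ≥0∞ := typeIBound (parabolicCylinder (1 / 2) (0 : ℝ × E3)) v πv Gv with hI₀
  have hI₀top : I₀ ≠ ⊤ := htypeI.ne
  -- ## (2) the scales `c k = 1/(k+4) ↓ 0` and the zoom sequence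
  set c : ℕ → ℝ := fun k => 1 / ((k : ℝ) + 4) with hc
  have hcpos : ∀ k, 0 < c k := fun k => by simp only [hc]; positivity
  have hc4 : ∀ k, c k ≤ 1 / 4 := fun k =>
    div_le_div_of_nonneg_left zero_le_one (by norm_num) (by linarith [(Nat.cast_nonneg k : (0 : ℝ) ≤ k)])
  have hc2 : ∀ k, c k ≤ 1 / 2 := fun k => (hc4 k).trans (by norm_num)
  have hclim : Tendsto c atTop (𝓝 0) :=
    tendsto_const_nhds.div_atTop (tendsto_atTop_add_const_right _ _ tendsto_natCast_atTop_atTop)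
  set w : ℕ → ℝ → E3 → E3 :=
    fun k => (c k * α) • stPull (c k ^ 2 * β) (c k * R) T x₀ u with hw
  -- the final windows `(A k, 0)`, `A k → -∞`
  set A : ℕ → ℝ := fun k => -(δ / (c k ^ 2 * β)) with hA
  have hAk : ∀ k, A k = -(δ / β * ((k : ℝ) + 4) ^ 2) := by
    intro k
    simp only [hA, hc]
    field_simp
  have hAlim : Tendsto A atTop atBot := by
    have h1 : Tendsto (fun k : ℕ => ((k : ℝ) + 4) ^ 2) atTop atTop :=
      (tendsto_pow_atTop two_ne_zero).comp
        (tendsto_atTop_add_const_right _ _ tendsto_natCast_atTop_atTop)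
    have h2 : Tendsto (fun k : ℕ => δ / β * ((k : ℝ) + 4) ^ 2) atTop atTop :=
      h1.const_mul_atTop (by positivity)
    refine (tendsto_neg_atTop_atBot.comp h2).congr fun k => ?_
    rw [hAk k]
    rfl
  -- ## (3) per-scale facts
  have hcW : ∀ k, ContinuousOn (uncurry (w k)) (Ioo (A k) 0 ×ˢ univ) := fun k =>
    zoom_continuousOn hν hsol hR hαeq hβeq (hcpos k) hδT
  have hdivW : ∀ k, ∀ t ∈ Ioo (A k) 0, IsWeaklyDivFree (w k t) := fun k t ht =>
    zoom_isWeaklyDivFree hν hsol hR hαeq hβeq (hcpos k) hδT ht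
  have hmildW : ∀ k, ∀ s t : ℝ, A k < s → s < t → t < 0 → ∀ y,
      w k t y = UnboundedOperators.heatExtension (w k s) (t - s) y -
        oseenDuhamel 1 s (w k) (w k) t y := fun k s t hs hst ht y =>
    zoom_oseen hν hT hsol hLH hdec hR hαeq hβeq (hcpos k) hδT hs hst ht y
  set C₁ : ℝ := α * C / Real.sqrt β with hC₁
  have hIW : ∀ k, ∀ t ∈ Ioo (A k) 0, ∀ y, ‖w k t y‖ ≤ C₁ / Real.sqrt (-t) := fun k t ht y =>
    zoom_norm_le hR hαeq hβeq hν (hcpos k) hδT hrate ht y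
  -- ## (4) extraction of the `C¹_loc` limit `W ∈ 𝒦_{C₁}`
  obtain ⟨φ, hφ, W, hWclass, hpt, -, -, -⟩ :=
    exists_tendsto_of_typeI_seq_Ioo C₁ hAlim hcW hdivW hmildW hIW
  have hφt : Tendsto φ atTop atTop := hφ.tendsto_atTop
  have hcφ : Tendsto (fun j => c (φ j)) atTop (𝓝 0) := hclim.comp hφt
  -- ## (6) `W` is unbounded at the origin
  have hsingW : ∀ r > 0, ∀ M : ℝ, ∃ t ∈ Ioo (-(r ^ 2)) (0 : ℝ),
      ∃ x ∈ ball (0 : E3) r, M < ‖W t x‖ :=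
    zoomSeq_unbounded_at_origin (πv := πv) hsol hR hα hβ hβT hsing hball hGv hI₀top
      (fun j => hcpos (φ j)) (fun j => hc2 (φ j)) fun z hz =>
        hpt z.1 ((SuitableCompactness.mem_parabolicCylinder_zero.1 hz).1.2) z.2
  -- ## (4b) NEW: a coherent top passes to the limit — all nonzero values of `W` share one direction
  have hwu : ∀ (j : ℕ) (t : ℝ) (y : E3),
      w (φ j) t y = (c (φ j) * α) • u (T + c (φ j) ^ 2 * β * t) (x₀ + (c (φ j) * R) • y) :=
    fun j t y => by simp only [hw, smul_stPull_apply]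
  have hcα : Tendsto (fun j => c (φ j) * α) atTop (𝓝 0) := by
    simpa using hcφ.mul_const α
  have hcR : Tendsto (fun j => c (φ j) * R) atTop (𝓝 0) := by
    simpa using hcφ.mul_const R
  have hτlim : ∀ t : ℝ, Tendsto (fun j => T + c (φ j) ^ 2 * β * t) atTop (𝓝 T) := by
    intro t
    have h : Tendsto (fun j => T + c (φ j) ^ 2 * β * t) atTop (𝓝 (T + 0 ^ 2 * β * t)) :=
      (((hcφ.pow 2).mul_const β).mul_const t).const_add T
    rw [zero_pow two_ne_zero, zero_mul, zero_mul, add_zero] at h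
    exact h
  have hτT : ∀ (j : ℕ) (t : ℝ), t < 0 → T + c (φ j) ^ 2 * β * t < T := by
    intro j t ht
    have : 0 < c (φ j) ^ 2 * β := by positivity
    nlinarith
  -- points of the limit where `W ≠ 0` come from top points, eventually
  have htop : ∀ t < 0, ∀ y : E3, W t y ≠ 0 → ∀ Λ : ℝ,
      ∀ᶠ j in atTop, Λ < ‖u (T + c (φ j) ^ 2 * β * t) (x₀ + (c (φ j) * R) • y)‖ := by
    intro t ht y hne Λ
    have hpos : 0 < ‖W t y‖ := norm_pos_iff.2 hne
    have f1 : ∀ᶠ j in atTop, ‖W t y‖ / 2 < ‖w (φ j) t y‖ :=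
      ((hpt t ht y).norm).eventually_const_lt (by linarith)
    have f2 : ∀ᶠ j in atTop, c (φ j) * α * (|Λ| + 1) < ‖W t y‖ / 2 := by
      have h : Tendsto (fun j => c (φ j) * α * (|Λ| + 1)) atTop (𝓝 (0 * (|Λ| + 1))) :=
        hcα.mul_const _
      rw [zero_mul] at h
      exact h.eventually_lt_const (by linarith)
    filter_upwards [f1, f2] with j hj1 hj2
    by_contra hle
    push Not at hle
    have hcαj : 0 < c (φ j) * α := mul_pos (hcpos _) hα
    have hn : ‖w (φ j) t y‖ = c (φ j) * α * ‖u (T + c (φ j) ^ 2 * β * t) (x₀ + (c (φ j) * R) • y)‖ := by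
      rw [hwu, norm_smul, Real.norm_eq_abs, abs_of_pos hcαj]
    have hle' : ‖u (T + c (φ j) ^ 2 * β * t) (x₀ + (c (φ j) * R) • y)‖ ≤ |Λ| + 1 :=
      hle.trans ((le_abs_self Λ).trans (by linarith))
    have : ‖w (φ j) t y‖ ≤ c (φ j) * α * (|Λ| + 1) := by
      rw [hn]; exact mul_le_mul_of_nonneg_left hle' hcαj.le
    linarith
  have haxlim : ∀ t < 0, ∀ t' < 0, ∀ y y' : E3, W t y ≠ 0 → W t' y' ≠ 0 →
      dir (W t' y') = dir (W t y) ∨ dir (W t' y') = -dir (W t y) := by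
    intro t ht t' ht' y y' h1 h2
    have hle : ∀ ε : ℝ, 0 < ε → axDist (W t y) (W t' y') ≤ ε := by
      intro ε hε
      obtain ⟨δ₁, hδ₁, Λ, t₁, ht₁T, hmod⟩ := hcoh ε hε
      have e1 : ∀ᶠ j in atTop, t₁ < T + c (φ j) ^ 2 * β * t := (hτlim t).eventually_const_lt ht₁T
      have e1' : ∀ᶠ j in atTop, t₁ < T + c (φ j) ^ 2 * β * t' :=
        (hτlim t').eventually_const_lt ht₁T
      have e2 : ∀ᶠ j in atTop,
          |(T + c (φ j) ^ 2 * β * t) - (T + c (φ j) ^ 2 * β * t')| < δ₁ ^ 2 := by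
        have h : Tendsto (fun j => |(T + c (φ j) ^ 2 * β * t) - (T + c (φ j) ^ 2 * β * t')|) atTop
            (𝓝 (|T - T|)) := ((hτlim t).sub (hτlim t')).abs
        rw [sub_self, abs_zero] at h
        exact h.eventually_lt_const (by positivity)
      have e3 : ∀ᶠ j in atTop, ‖(x₀ + (c (φ j) * R) • y) - (x₀ + (c (φ j) * R) • y')‖ < δ₁ := by
        have hid : ∀ j, (x₀ + (c (φ j) * R) • y) - (x₀ + (c (φ j) * R) • y') =
            (c (φ j) * R) • (y - y') := fun j => by rw [smul_sub]; abel
        have h : Tendsto (fun j => ‖(c (φ j) * R) • (y - y')‖) atTop (𝓝 (‖(0 : ℝ)‖ * ‖y - y'‖)) := by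
          simp_rw [norm_smul]
          exact hcR.norm.mul_const _
        rw [norm_zero, zero_mul] at h
        simp_rw [hid]
        exact h.eventually_lt_const hδ₁
      have e4 := htop t ht y h1 Λ
      have e4' := htop t' ht' y' h2 Λ
      have hev : ∀ᶠ j in atTop, axDist (w (φ j) t y) (w (φ j) t' y') ≤ ε := by
        filter_upwards [e1, e1', e2, e3, e4, e4'] with j hj1 hj1' hj2 hj3 hj4 hj4'
        rw [hwu j t y, hwu j t' y', axDist_smul_of_pos (mul_pos (hcpos _) hα) (mul_pos (hcpos _) hα)]
        exact hmod _ ⟨hj1, hτT j t ht⟩ _ ⟨hj1', hτT j t' ht'⟩ _ _ hj2 hj3 hj4 hj4'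
      have hpair : Tendsto (fun j => (w (φ j) t y, w (φ j) t' y')) atTop (𝓝 (W t y, W t' y')) :=
        (hpt t ht y).prodMk_nhds (hpt t' ht' y')
      have hlim : Tendsto (fun j => axDist (w (φ j) t y) (w (φ j) t' y')) atTop
          (𝓝 (axDist (W t y) (W t' y'))) :=
        ((continuousAt_axDist h1 h2).tendsto.comp hpair :)
      exact le_of_tendsto hlim hev
    by_contra hcon
    push Not at hcon
    have hpos : 0 < axDist (W t y) (W t' y') := by
      show 0 < min _ _
      apply lt_min
      · exact norm_pos_iff.2 (sub_ne_zero.2 (Ne.symm hcon.1))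
      · refine norm_pos_iff.2 fun h => hcon.2 ?_
        exact (add_eq_zero_iff_neg_eq.1 h).symm
    have := hle _ (half_pos hpos)
    linarith
  -- ## (7) assemble
  obtain ⟨ts, hts, xs, -, hM⟩ := hsingW 1 one_pos 0
  have hne : W ts xs ≠ 0 := by
    intro h0; rw [h0, norm_zero] at hM; exact lt_irrefl _ hM
  refine ⟨C₁, W, dir (W ts xs), hWclass, norm_dir hne, fun t ht y => ?_, ts, hts.2, xs, hne⟩
  rcases eq_or_ne (W t y) 0 with h0 | hne'
  · rw [h0, inner_zero_left, zero_smul]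
  · rcases haxlim ts hts.2 t ht xs y hne hne' with h | h
    · have hW : W t y = ‖W t y‖ • dir (W ts xs) := by
        rw [← h]; exact (norm_smul_dir _).symm
      have hi : ⟪‖W t y‖ • dir (W ts xs), dir (W ts xs)⟫ = ‖W t y‖ := by
        rw [real_inner_smul_left, real_inner_self_eq_norm_sq, norm_dir hne]; ring
      conv_rhs => rw [hW, hi]
      exact hW
    · have hW : W t y = (-‖W t y‖) • dir (W ts xs) := by
        rw [neg_smul, ← smul_neg, ← h]; exact (norm_smul_dir _).symm
      have hi : ⟪(-‖W t y‖) • dir (W ts xs), dir (W ts xs)⟫ = -‖W t y‖ := by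
        rw [real_inner_smul_left, real_inner_self_eq_norm_sq, norm_dir hne]; ring
      conv_rhs => rw [hW, hi]
      exact hW

/-! ## §4 Headlines -/

/-- **Criterion row F1ax is EXCLUDED** (rev 2, in kernel): a classical Leray–Hopf solution from a
rapidly decaying datum with at most the Type-I rate at `T` whose fast fluid keeps a coherent AXIS
extends smoothly past `T`.  Proof: at a would-be backward-singular point the axial singular zoom limit
(`exists_axial_zoomLimit`) is a nonzero axial element of `𝒦_C`, which `eq_zero_of_axial` forbids; hence
every point has a bounded backward cylinder and Lemarié-Rieusset's Thm 15.1 (C) extends `u`.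
(refs: LemarieRieusset2016, Thm 15.1 (C); AlbrittonBarker2019, §3; KochNadirashviliSereginSverak2009, Thm 5.1 and §6) -/
theorem rowF1ax_holds : Row_F1ax := by
  intro ν T hν hT u p hsol hLH hdec hTI hcoh
  apply hasSmoothExtensionPast_of_forall_exists_parabolicCylinder hν hT hsol hLH hdec
  intro x₀
  by_contra hno
  have hsing : ∀ r : ℝ, 0 < r →
      eLpNorm (uncurry u) ∞ (volume.restrict (parabolicCylinder r ((T : ℝ), x₀))) = ∞ := by
    intro r hr
    by_contra h
    exact hno ⟨r, hr, lt_top_iff_ne_top.2 h⟩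
  obtain ⟨C, W, e, hW, he, hax, t, ht, y, hne⟩ :=
    exists_axial_zoomLimit hν hT hsol hLH hdec hTI hcoh x₀ hsing
  exact hne (eq_zero_of_axial hW he hax t ht y)

/-- **Criterion row F1dir is EXCLUDED** (in kernel; corollary of `rowF1ax_holds`): a classical
Leray–Hopf solution from a rapidly decaying datum with at most the Type-I rate at `T` whose fast fluid
does not veer (coherent top) extends smoothly past `T`. (refs: LemarieRieusset2016, Thm 15.1 (C); KochNadirashviliSereginSverak2009, Thm 5.1 and §6) -/
theorem rowF1dir_holds : Row_F1dir := rowF1dir_of_rowF1ax rowF1ax_holds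

/-- **Type-I Clay blow-ups change AXIS at all scales** (rev 2 structural theorem, in kernel): a maximal
classical Leray–Hopf solution from a rapidly decaying datum which blows up at `T` at the Type-I rate has
NO coherent axis. (refs: KochNadirashviliSereginSverak2009, §6 (arXiv:0709.3599); arXiv:1511.02807, Cor. 2.3) -/
theorem topAxisVeering_holds : ∀ (ν T : ℝ), 0 < ν → 0 < T →
    ∀ (u : ℝ → E3 → E3) (p : ℝ → E3 → ℝ),
    IsMaximalSmoothSolution ν 0 u p T → IsLerayHopfOn T ν 0 (u 0) u →
    HasRapidSpatialDecay (u 0) → IsTypeIBlowup u T → ¬ HasCoherentAxis u T :=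
  fun ν T hν hT u p hmax hLH hdec hTI hcoh =>
    hmax.2 (rowF1ax_holds ν T hν hT u p hmax.1 hLH hdec hTI hcoh)

/-- **Type-I Clay blow-ups VEER** (structural theorem, in kernel): a maximal classical Leray–Hopf
solution from a rapidly decaying datum which blows up at `T` at the Type-I rate has NO coherent top —
for some `ε > 0`, at every threshold `Λ`, every parabolic scale `δ` and arbitrarily close to `T` there
are two top points at parabolic distance `< δ` whose velocity directions differ by more than `ε`.
(refs: KochNadirashviliSereginSverak2009, §6 (arXiv:0709.3599); arXiv:1310.6471, Thm 1.2) -/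
theorem topVeering_holds : ∀ (ν T : ℝ), 0 < ν → 0 < T →
    ∀ (u : ℝ → E3 → E3) (p : ℝ → E3 → ℝ),
    IsMaximalSmoothSolution ν 0 u p T → IsLerayHopfOn T ν 0 (u 0) u →
    HasRapidSpatialDecay (u 0) → IsTypeIBlowup u T → ¬ HasCoherentTop u T :=
  fun ν T hν hT u p hmax hLH hdec hTI hcoh =>
    topAxisVeering_holds ν T hν hT u p hmax hLH hdec hTI hcoh.hasCoherentAxis

/-- **Row F1 ≡ TopCoherence** (exact reformulation, in kernel): row F1 holds iff every Type-I Clay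
blow-up has a coherent top. (folklore) -/
theorem topCoherence_iff_rowF1 : TopCoherence ↔ ScenarioCensus.Row_F1 :=
  ⟨fun h => rowF1_of rowF1dir_holds h, topCoherence_of_rowF1⟩

/-- **Row F1 ≡ AxisCoherence** (rev 2; exact reformulation, in kernel). (folklore) -/
theorem axisCoherence_iff_rowF1 : AxisCoherence ↔ ScenarioCensus.Row_F1 :=
  ⟨fun h => rowF1_of_ax rowF1ax_holds h, axisCoherence_of_rowF1⟩

/-- **Composition concluding the target BY NAME**: `TopCoherence → Row_F1`. -/
theorem rowF1_of_topCoherence : TopCoherence → ScenarioCensus.Row_F1 :=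
  topCoherence_iff_rowF1.1

/-- **Composition concluding the target BY NAME** (axis form): `AxisCoherence → Row_F1`. -/
theorem rowF1_of_axisCoherence : AxisCoherence → ScenarioCensus.Row_F1 :=
  axisCoherence_iff_rowF1.1

end Summit.NavierStokesRegularity.NavierStokesRegularity.Theorems.ScenarioCensus.OneWayTop

/-! ## Census keys -/

namespace Summit.NavierStokesRegularity.NavierStokesRegularity.Theorems.ScenarioCensus

/-- Census row F1ax — (Type I · no symmetry · Clay class: classical on `ℝ³ × [0,T)`, Leray–Hopf from a
rapidly decaying datum, Type-I blow-up rate at `T` · COHERENT AXIS of the fast fluid,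
`OneWayTop.HasCoherentAxis u T`: on the top `{Λ < ‖u‖}` near `T` nearby points have velocity directions
`ε`-close UP TO SIGN): the solution extends smoothly past `T`. BY NAME the line's Prop
`OneWayTop.Row_F1ax`; EXCLUDED-IN-TREE (`row_F1ax_excluded`). -/
def Row_F1ax : Prop := OneWayTop.Row_F1ax

/-- **Census row F1ax is EXCLUDED-IN-TREE** (the axial singular Type-I zoom limit vanishes). -/
theorem row_F1ax_excluded : Row_F1ax := OneWayTop.rowF1ax_holds

/-- In-row criterion F1dir (coherent DIRECTION of the fast fluid, `OneWayTop.HasCoherentTop`; contained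
in F1ax): BY NAME the line's Prop `OneWayTop.Row_F1dir`; EXCLUDED-IN-TREE (`row_F1dir_excluded`). -/
def Row_F1dir : Prop := OneWayTop.Row_F1dir

/-- **Criterion F1dir is EXCLUDED-IN-TREE** (corollary of `row_F1ax_excluded`). -/
theorem row_F1dir_excluded : Row_F1dir := OneWayTop.rowF1dir_holds

/-- F1ax ⇒ F1dir. -/
theorem row_F1dir_of_row_F1ax (h : Row_F1ax) : Row_F1dir := OneWayTop.rowF1dir_of_rowF1ax h

/-- The residual of row F1 after the split: every Type-I Clay blow-up has a coherent axis (BY NAME the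
line's Prop `OneWayTop.AxisCoherence`; OPEN — it is equivalent to `Row_F1`). [conjecture] -/
def AxisCoherence : Prop := OneWayTop.AxisCoherence

/-- **Row F1 is EXACTLY the axis-coherence of Type-I Clay blow-ups**: `Row_F1 ↔ AxisCoherence`. -/
theorem row_F1_iff_axisCoherence : Row_F1 ↔ AxisCoherence := OneWayTop.axisCoherence_iff_rowF1.symm

/-- `Row_F1ax ∧ AxisCoherence → Row_F1` (the split). -/
theorem row_F1_of_row_F1ax_of_axisCoherence (hD : Row_F1ax) (hAC : AxisCoherence) : Row_F1 :=
  OneWayTop.rowF1_of_ax hD hAC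

end Summit.NavierStokesRegularity.NavierStokesRegularity.Theorems.ScenarioCensus

end
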